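import Literature.AnabelianGeometry.EtaleTheta.SettingModelHeisenberg
import Mathlib.GroupTheory.CoprodI
import Mathlib.GroupTheory.ResiduallyFinite
import Mathlib.GroupTheory.NoncommCoprod
import Mathlib.Topology.Algebra.Category.ProfiniteGrp.Completion
import Literature.AnabelianGeometry.SemiGraphs.TemperedAnabelian
import HarnessLib

/-!
# A model of the [EtTh] §1 root, part B: `F₂ ↪ F̂₂` and the class-2 shadow of the theta quotient

Mochizuki, *The étale theta function …*, Publ. RIMS **45** (2009) [EtTh], §1, PRIMS PDF p. 12
[cite: MochizukiEtTh2009, §1 p.12]: "`Δ_X` … is a profinite free group on 2 generators",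
"`Δ^Θ_X := Δ_X/[Δ_X,[Δ_X,Δ_X]]`"; [SemiAnbd] §6 p. 69 "natural injection `Π^temp ↪ Π`" (residual
finiteness of free groups). Layer L2 of the abc-iut cell, seat abc-iut-L2-t1 (root owner); SECOND file
of the explicit inhabitant of the L2 root `ThetaSetting p` (vacuity lane; see
`SettingModelHeisenberg.lean` for the framing — a model is consistency evidence only).

Contents. (1) **The free group `F₂` is residually finite** (`residuallyFinite_freeGroup_two`):
the shears `(x,y) ↦ (x+3y, y)`, `(x,y) ↦ (x, y+3x)` of `ℤ² ∖ 0` generate a free group (Mathlib's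
ping-pong lemma `FreeGroup.injective_lift_of_ping_pong`), and a nontrivial word is detected in the
finite permutation group of `(ℤ/m)²` for `m` large. (2) The profinite completion `F̂₂` (Mathlib
`ProfiniteGrp.ProfiniteCompletion`) with the injection `eta : F₂ ↪ F̂₂` — the model of
`Δ^tp_X ↪ Δ_X`. (3) Every homomorphism `F₂ → Q` to a finite group extends continuously to `F̂₂`
(`exists_continuousMonoidHom_extend`). (4) **The class-2 shadow**: if `eta g` lies in the CLOSURE of
`[[F̂₂,F̂₂],F̂₂]`, then `g` dies in the Heisenberg group `Heis ℤ` (`heisHom_eq_one_of_eta_mem_closure`)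
— the step that will give `Ker(Π^tp_X ↠ (Π^tp_X)^Θ) ∩ Π^tp_{Y_N} ⊆ Π^tp_{Z_N}` (root field
`ker_toTheta_le_GtpZN`) in the model. No instances, no Prop facts; nothing of [EtTh] is asserted; no
side is taken on [IUTchIII] Cor. 3.12.
-/

noncomputable section

namespace Literature.AnabelianGeometry.EtaleTheta.SettingModel

open scoped commutatorElement Pointwise
open CategoryTheory

/-! ### Residual finiteness of `F₂` by ping-pong on `ℤ² ∖ 0` -/

namespace PingPong

/-- The nonzero vectors of `ℤ²` (the ping-pong table). [folklore] -/
private abbrev V : Type := {v : ℤ × ℤ // v ≠ 0}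

/-- The shear `(x, y) ↦ (x + 3y, y)` of `ℤ²`. [folklore] -/
private def shearX : ℤ × ℤ ≃ ℤ × ℤ where
  toFun v := (v.1 + 3 * v.2, v.2)
  invFun v := (v.1 - 3 * v.2, v.2)
  left_inv v := by ext <;> simp
  right_inv v := by ext <;> simp

/-- The shear `(x, y) ↦ (x, y + 3x)` of `ℤ²`. [folklore] -/
private def shearY : ℤ × ℤ ≃ ℤ × ℤ where
  toFun v := (v.1, v.2 + 3 * v.1)
  invFun v := (v.1, v.2 - 3 * v.1)
  left_inv v := by ext <;> simp
  right_inv v := by ext <;> simp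

/-- `shearX` preserves `ℤ² ∖ 0`. [folklore] -/
private theorem shearX_ne_zero (v : ℤ × ℤ) : v ≠ 0 ↔ shearX v ≠ 0 := by
  simp only [ne_eq, Prod.ext_iff, shearX, Equiv.coe_fn_mk, Prod.fst_zero, Prod.snd_zero]
  omega

/-- `shearY` preserves `ℤ² ∖ 0`. [folklore] -/
private theorem shearY_ne_zero (v : ℤ × ℤ) : v ≠ 0 ↔ shearY v ≠ 0 := by
  simp only [ne_eq, Prod.ext_iff, shearY, Equiv.coe_fn_mk, Prod.fst_zero, Prod.snd_zero]
  omega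

/-- The two shears as permutations of `ℤ² ∖ 0`. [folklore] -/
private def gen : Fin 2 → Equiv.Perm V :=
  ![shearX.subtypeEquiv shearX_ne_zero, shearY.subtypeEquiv shearY_ne_zero]

/-- `a·(x,y) = (x+3y, y)`. [folklore] -/
private theorem gen0_val (v : V) : ((gen 0) v).1 = (v.1.1 + 3 * v.1.2, v.1.2) := rfl
/-- `b·(x,y) = (x, y+3x)`. [folklore] -/
private theorem gen1_val (v : V) : ((gen 1) v).1 = (v.1.1, v.1.2 + 3 * v.1.1) := rfl
/-- `a⁻¹·(x,y) = (x−3y, y)`. [folklore] -/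
private theorem gen0_inv_val (v : V) : ((gen 0)⁻¹ v).1 = (v.1.1 - 3 * v.1.2, v.1.2) := rfl
/-- `b⁻¹·(x,y) = (x, y−3x)`. [folklore] -/
private theorem gen1_inv_val (v : V) : ((gen 1)⁻¹ v).1 = (v.1.1, v.1.2 - 3 * v.1.1) := rfl
/-- `a⁻¹` via `symm`. [folklore] -/
private theorem gen0_symm_val (v : V) : ((gen 0).symm v).1 = (v.1.1 - 3 * v.1.2, v.1.2) := rfl
/-- `b⁻¹` via `symm`. [folklore] -/
private theorem gen1_symm_val (v : V) : ((gen 1).symm v).1 = (v.1.1, v.1.2 - 3 * v.1.1) := rfl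

/-- The representation `F₂ → Perm(ℤ² ∖ 0)`, `a ↦ shearX 3`, `b ↦ shearY 3`. [folklore] -/
private def rho : F₂ →* Equiv.Perm V := FreeGroup.lift gen

/-- Attracting region of `a`: `|y| < |x|` with `x, y` of the same sign, or the axis `y = 0`. [folklore] -/
private def X0 : Set V :=
  {v | (v.1.2.natAbs < v.1.1.natAbs ∧ (0 < v.1.1 ∧ 0 < v.1.2 ∨ v.1.1 < 0 ∧ v.1.2 < 0)) ∨ v.1.2 = 0}

/-- Attracting region of `a⁻¹`: `|y| < |x|` with `x, y` of opposite signs. [folklore] -/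
private def Y0 : Set V :=
  {v | v.1.2.natAbs < v.1.1.natAbs ∧ (0 < v.1.1 ∧ v.1.2 < 0 ∨ v.1.1 < 0 ∧ 0 < v.1.2)}

/-- Attracting region of `b`: `|x| < |y|` same sign, or the axis `x = 0`. [folklore] -/
private def X1 : Set V :=
  {v | (v.1.1.natAbs < v.1.2.natAbs ∧ (0 < v.1.1 ∧ 0 < v.1.2 ∨ v.1.1 < 0 ∧ v.1.2 < 0)) ∨ v.1.1 = 0}

/-- Attracting region of `b⁻¹`: `|x| < |y|` opposite signs. [folklore] -/
private def Y1 : Set V :=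
  {v | v.1.1.natAbs < v.1.2.natAbs ∧ (0 < v.1.1 ∧ v.1.2 < 0 ∨ v.1.1 < 0 ∧ 0 < v.1.2)}

/-- **`rho : F₂ → Perm(ℤ² ∖ 0)` is injective** (ping-pong). [folklore] -/
private theorem rho_injective : Function.Injective rho := by
  refine FreeGroup.injective_lift_of_ping_pong gen ![X0, X1] ![Y0, Y1] ?_ ?_ ?_ ?_ ?_ ?_
  · intro i
    fin_cases i
    · exact ⟨⟨(1, 0), by simp⟩, Or.inr rfl⟩
    · exact ⟨⟨(0, 1), by simp⟩, Or.inr rfl⟩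
  · intro i j hij
    fin_cases i <;> fin_cases j <;> simp only [Fin.isValue, ne_eq, not_true_eq_false,
      Fin.zero_eta, Fin.mk_one, Fin.reduceEq, not_false_eq_true] at hij ⊢ <;>
      refine Set.disjoint_left.mpr fun v h1 h2 => ?_ <;>
      · have hv := v.2
        simp only [Matrix.cons_val_zero, Matrix.cons_val_one, X0, X1, ne_eq, Prod.ext_iff,
          Prod.fst_zero, Prod.snd_zero, Set.mem_setOf_eq] at h1 h2 hv
        omega
  · intro i j hij
    fin_cases i <;> fin_cases j <;> simp only [Fin.isValue, ne_eq, not_true_eq_false,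
      Fin.zero_eta, Fin.mk_one, Fin.reduceEq, not_false_eq_true] at hij ⊢ <;>
      refine Set.disjoint_left.mpr fun v h1 h2 => ?_ <;>
      · simp only [Matrix.cons_val_zero, Matrix.cons_val_one, Y0, Y1, Set.mem_setOf_eq] at h1 h2
        omega
  · intro i j
    fin_cases i <;> fin_cases j <;>
      refine Set.disjoint_left.mpr fun v h1 h2 => ?_ <;>
      · have hv := v.2
        simp only [Fin.zero_eta, Fin.mk_one, Fin.isValue, Matrix.cons_val_zero, Matrix.cons_val_one,
          X0, X1, Y0, Y1, ne_eq, Prod.ext_iff, Prod.fst_zero, Prod.snd_zero, Set.mem_setOf_eq]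
          at h1 h2 hv
        omega
  · intro i
    fin_cases i <;>
    · rintro _ ⟨v, hv, rfl⟩
      have hv0 := v.2
      simp only [Fin.zero_eta, Fin.mk_one, Fin.isValue, Matrix.cons_val_zero, Matrix.cons_val_one,
        Matrix.cons_val_fin_one, Set.mem_compl_iff, X0, X1, Y0, Y1, Set.mem_setOf_eq, ne_eq,
        Prod.ext_iff, Prod.fst_zero, Prod.snd_zero, Equiv.Perm.smul_def, gen0_val, gen1_val]
        at hv hv0 ⊢
      omega
  · intro i
    fin_cases i <;>
    · rintro _ ⟨v, hv, rfl⟩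
      have hv0 := v.2
      simp only [Fin.zero_eta, Fin.mk_one, Fin.isValue, Pi.inv_apply, Matrix.cons_val_zero,
        Matrix.cons_val_one, Matrix.cons_val_fin_one, Set.mem_compl_iff, X0, X1, Y0, Y1,
        Set.mem_setOf_eq, ne_eq, Prod.ext_iff, Prod.fst_zero, Prod.snd_zero, Equiv.Perm.smul_def,
        gen0_inv_val, gen1_inv_val] at hv hv0 ⊢
      omega

/-- The same shears on `(ℤ/m)²` (a finite permutation group). [folklore] -/
private def genMod (m : ℕ) : Fin 2 → Equiv.Perm (ZMod m × ZMod m) :=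
  ![{ toFun := fun v => (v.1 + 3 * v.2, v.2), invFun := fun v => (v.1 - 3 * v.2, v.2),
      left_inv := fun v => by ext <;> simp, right_inv := fun v => by ext <;> simp },
    { toFun := fun v => (v.1, v.2 + 3 * v.1), invFun := fun v => (v.1, v.2 - 3 * v.1),
      left_inv := fun v => by ext <;> simp, right_inv := fun v => by ext <;> simp }]

/-- Reduction mod `m` of `ℤ²`. [folklore] -/
private def red (m : ℕ) (v : ℤ × ℤ) : ZMod m × ZMod m := ((v.1 : ZMod m), (v.2 : ZMod m))

/-- The mod-`m` action is compatible with the action on `ℤ² ∖ 0`. [folklore] -/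
private theorem red_rho (m : ℕ) (g : F₂) (v : V) :
    red m (rho g v).1 = FreeGroup.lift (genMod m) g (red m v.1) := by
  induction g using FreeGroup.induction_on generalizing v with
  | C1 => simp
  | of i =>
    fin_cases i <;>
      simp [rho, genMod, red, gen0_val, gen1_val]
  | inv_of i _ =>
    fin_cases i <;>
      simp [rho, genMod, red, gen0_symm_val, gen1_symm_val]
  | mul x y hx hy => simp [map_mul, Equiv.Perm.mul_apply, hx, hy]

end PingPong

open PingPong in
/-- **The free group on two generators is residually finite** ([SemiAnbd] §6 p. 69: the "natural
injection `Π^temp_{X_K} ↪ Π_{X_K}`" rests on the residual finiteness of free groups). Proof: ping-pong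
embeds `F₂` in `Perm(ℤ² ∖ 0)`; a nontrivial word moves a basis vector `v`, and reducing modulo
`m > ‖g·v − v‖` detects it in the finite group `Perm((ℤ/m)²)`. [cite: MochizukiEtTh2009, §1 p.12] -/
theorem residuallyFinite_freeGroup_two : Group.ResiduallyFinite F₂ := by
  refine Group.residuallyFinite_of_forall_exists_finite_monoidHom fun g hg => ?_
  have hρ : rho g ≠ 1 := fun h => hg (rho_injective (by rw [h, map_one]))
  obtain ⟨v, hv⟩ : ∃ v : V, rho g v ≠ v := by
    by_contra! h
    exact hρ (Equiv.ext h)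
  -- choose `m` exceeding the coordinates of the difference
  set w := (rho g v).1 with hw
  have hne : w ≠ v.1 := fun h => hv (Subtype.ext h)
  set m : ℕ := (w.1 - v.1.1).natAbs + (w.2 - v.1.2).natAbs + 1 with hm
  refine ⟨Equiv.Perm (ZMod m × ZMod m), inferInstance, inferInstance, FreeGroup.lift (genMod m), ?_⟩
  intro h1
  have key := red_rho m g v
  rw [h1, Equiv.Perm.one_apply, ← hw] at key
  simp only [red, Prod.ext_iff] at key
  rw [ZMod.intCast_eq_intCast_iff_dvd_sub, ZMod.intCast_eq_intCast_iff_dvd_sub] at key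
  have h0 : ∀ t : ℤ, (m : ℤ) ∣ t → t.natAbs < m → t = 0 := fun t ht hlt =>
    Int.eq_zero_of_dvd_of_natAbs_lt_natAbs ht (by simpa using hlt)
  have e1 : v.1.1 - w.1 = 0 := h0 _ key.1 (by omega)
  have e2 : v.1.2 - w.2 = 0 := h0 _ key.2 (by omega)
  exact hne (Prod.ext (by omega) (by omega))

/-! ### The profinite completion `F̂₂` and the injection `F₂ ↪ F̂₂` -/

/-- `F̂₂`, the profinite completion of `F₂` (Mathlib's `ProfiniteGrp.ProfiniteCompletion`) — the model
of "`Δ_X` … a profinite free group on 2 generators" ([EtTh] p. 12). [cite: MochizukiEtTh2009, §1 p.12] -/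
abbrev F₂hat : ProfiniteGrp.{0} := ProfiniteGrp.ProfiniteCompletion.completion (GrpCat.of F₂)

/-- `η : F₂ → F̂₂`, the model of the "natural injection" `Δ^tp_X ↪ Δ_X` ([SemiAnbd] §6 p. 69;
[EtTh] p. 12). [cite: MochizukiEtTh2009, §1 p.12] -/
def eta : F₂ →* F₂hat := (ProfiniteGrp.ProfiniteCompletion.eta (GrpCat.of F₂)).hom

/-- [cite: MochizukiEtTh2009, §1 p.12] -/
theorem eta_apply (g : F₂) : eta g = ProfiniteGrp.ProfiniteCompletion.etaFn (GrpCat.of F₂) g := rfl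

/-- **`η : F₂ → F̂₂` is injective** (residual finiteness). [cite: MochizukiEtTh2009, §1 p.12] -/
theorem eta_injective : Function.Injective eta := by
  haveI := residuallyFinite_freeGroup_two
  exact (ProfiniteGrp.ProfiniteCompletion.etaFn_injective_iff_residuallyFinite
    (GrpCat.of F₂)).mpr inferInstance

/-- `η` has dense range. [cite: MochizukiEtTh2009, §1 p.12] -/
theorem denseRange_eta : DenseRange eta :=
  ProfiniteGrp.ProfiniteCompletion.denseRange (G := GrpCat.of F₂)

/-- **Universal property, existence half**: every homomorphism from a (discrete) group `G` to a finite
discrete group extends to a continuous homomorphism on the profinite completion (the universal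
property behind "we shall denote the profinite completion of a group by means of a `∧`", [SemiAnbd] §6
p. 69 / [EtTh] p. 12). [cite: MochizukiEtTh2009, §1 p.12] -/
theorem exists_continuousMonoidHom_extend (G : Type) [Group G] (Q : Type) [Group Q] [Finite Q]
    [TopologicalSpace Q] [DiscreteTopology Q] (f : G →* Q) :
    ∃ F : ProfiniteGrp.ProfiniteCompletion.completion (GrpCat.of G) →ₜ* Q,
      ∀ g, F (ProfiniteGrp.ProfiniteCompletion.etaFn (GrpCat.of G) g) = f g := by
  let Gc : GrpCat.{0} := GrpCat.of G
  let P : ProfiniteGrp.{0} := ProfiniteGrp.of Q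
  let φ : Gc ⟶ GrpCat.of P := GrpCat.ofHom f
  let L := ProfiniteGrp.ProfiniteCompletion.lift φ
  refine ⟨L.hom, fun g => ?_⟩
  have h := ConcreteCategory.congr_hom (ProfiniteGrp.ProfiniteCompletion.lift_eta φ) g
  simp only [GrpCat.comp_apply] at h
  exact h


/-! ### The profinite completion of a product of two discrete groups -/

/-- `η : G → Ĝ` as a continuous homomorphism out of the DISCRETE group `G` (the model's tempered
groups are discrete). [cite: MochizukiEtTh2009, §1 p.12] -/
def etaCont (G : Type) [Group G] [TopologicalSpace G] [DiscreteTopology G] :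
    G →ₜ* ProfiniteGrp.ProfiniteCompletion.completion (GrpCat.of G) where
  toMonoidHom := (ProfiniteGrp.ProfiniteCompletion.eta (GrpCat.of G)).hom
  continuous_toFun := continuous_of_discreteTopology

/-- [cite: MochizukiEtTh2009, §1 p.12] -/
theorem etaCont_apply (G : Type) [Group G] [TopologicalSpace G] [DiscreteTopology G] (g : G) :
    etaCont G g = ProfiniteGrp.ProfiniteCompletion.etaFn (GrpCat.of G) g := rfl

/-- **`Ĝ × Ĥ` is the profinite completion of the discrete group `G × H`** in the sense of the L3
interface `SemiGraphs.IsProfiniteCompletion` (compact Hausdorff totally disconnected, dense image, and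
every finite-index normal subgroup of `G × H` is pulled back from an open normal subgroup — obtained as
the kernel of the continuous extension `Ĝ × Ĥ → (G × H)/U` assembled from the two factors, whose images
commute by density). Used for `Π^tp_X = F₂ × G_{ℚ_p} ↪ Π_X = F̂₂ × Ĝ_{ℚ_p}` in the model.
[cite: MochizukiEtTh2009, §1 p.12] -/
theorem isProfiniteCompletion_prodMap_etaCont (G H : Type) [Group G] [TopologicalSpace G]
    [DiscreteTopology G] [Group H] [TopologicalSpace H] [DiscreteTopology H] :
    Literature.AnabelianGeometry.SemiGraphs.IsProfiniteCompletion
      ((etaCont G).prodMap (etaCont H)) := by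
  classical
  have dG := ProfiniteGrp.ProfiniteCompletion.denseRange (G := GrpCat.of G)
  have dH := ProfiniteGrp.ProfiniteCompletion.denseRange (G := GrpCat.of H)
  refine
    { compactSpace := inferInstance
      t2Space := inferInstance
      totallyDisconnectedSpace := inferInstance
      denseRange := dG.prodMap dH
      comap_surjective := ?_
      isOpen_comap := fun V => isOpen_discrete _ }
  intro U hU
  let Q : Type := (G × H) ⧸ U.toSubgroup
  letI : TopologicalSpace Q := ⊥
  haveI : DiscreteTopology Q := ⟨rfl⟩
  haveI : Finite Q := Subgroup.finite_quotient_of_finiteIndex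
  let π : G × H →* Q := QuotientGroup.mk' U.toSubgroup
  obtain ⟨P1, hP1⟩ := exists_continuousMonoidHom_extend G Q (π.comp (MonoidHom.inl G H))
  obtain ⟨P2, hP2⟩ := exists_continuousMonoidHom_extend H Q (π.comp (MonoidHom.inr G H))
  have hπ : ∀ g : G, ∀ h : H, π.comp (MonoidHom.inl G H) g * π.comp (MonoidHom.inr G H) h = π (g, h) := by
    intro g h
    rw [MonoidHom.comp_apply, MonoidHom.comp_apply, ← map_mul, MonoidHom.inl_apply,
      MonoidHom.inr_apply, Prod.mk_mul_mk, mul_one, one_mul]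
  have hπ' : ∀ g : G, ∀ h : H, π.comp (MonoidHom.inr G H) h * π.comp (MonoidHom.inl G H) g = π (g, h) := by
    intro g h
    rw [MonoidHom.comp_apply, MonoidHom.comp_apply, ← map_mul, MonoidHom.inl_apply,
      MonoidHom.inr_apply, Prod.mk_mul_mk, mul_one, one_mul]
  have hcomm : ∀ x y, Commute (P1 x) (P2 y) := by
    have key : (fun q : _ × _ => P1 q.1 * P2 q.2) = fun q => P2 q.2 * P1 q.1 := by
      refine (dG.prodMap dH).equalizer
        ((P1.continuous.comp continuous_fst).mul (P2.continuous.comp continuous_snd))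
        ((P2.continuous.comp continuous_snd).mul (P1.continuous.comp continuous_fst)) ?_
      funext gh
      change P1 (ProfiniteGrp.ProfiniteCompletion.etaFn _ gh.1) *
          P2 (ProfiniteGrp.ProfiniteCompletion.etaFn _ gh.2) =
        P2 (ProfiniteGrp.ProfiniteCompletion.etaFn _ gh.2) *
          P1 (ProfiniteGrp.ProfiniteCompletion.etaFn _ gh.1)
      rw [hP1, hP2, hπ, hπ']
    exact fun x y => congrFun key (x, y)
  let P : _ × _ →* Q := MonoidHom.noncommCoprod P1.toMonoidHom P2.toMonoidHom hcomm
  have hPc : Continuous P :=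
    (P1.continuous.comp continuous_fst).mul (P2.continuous.comp continuous_snd)
  have hopen : IsOpen (SetLike.coe P.ker) := by
    have : SetLike.coe P.ker = P ⁻¹' {1} := by
      ext x; simp [MonoidHom.mem_ker]
    rw [this]
    exact (isOpen_discrete _).preimage hPc
  refine ⟨{ toSubgroup := P.ker, isOpen' := hopen }, Subgroup.ext fun gh => ?_⟩
  rw [Subgroup.mem_comap, MonoidHom.mem_ker]
  change gh ∈ U.toSubgroup ↔ P1 (ProfiniteGrp.ProfiniteCompletion.etaFn _ gh.1) *
    P2 (ProfiniteGrp.ProfiniteCompletion.etaFn _ gh.2) = 1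
  rw [hP1, hP2, hπ, QuotientGroup.mk'_apply, QuotientGroup.eq_one_iff]

/-! ### The class-2 shadow: the closure of `[[F̂₂,F̂₂],F̂₂]` meets `F₂` inside `Ker(F₂ → Heis ℤ)` -/

/-- **If `η g` lies in the closure of `[[F̂₂, F̂₂], F̂₂]`, then `g ↦ 1` in `Heis ℤ`.** Every finite
class-2 quotient `F₂ → Heis (ℤ/M)` extends continuously to `F̂₂`, kills triple commutators
(`Heis.commutator_commutator_le_ker`) and hence — its kernel being closed — their closure; so the image
of `g` in `Heis ℤ` dies modulo every `M`. (The model's form of "the kernel of `Δ^tp_X ↠ (Δ^tp_X)^Θ` is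
induced by `Δ_X ↠ Δ_X/[Δ_X,[Δ_X,Δ_X]]`", [EtTh] p. 12.) [cite: MochizukiEtTh2009, §1 p.12] -/
theorem heisHom_eq_one_of_eta_mem_closure (g : F₂)
    (hg : eta g ∈ (⁅⁅(⊤ : Subgroup F₂hat), (⊤ : Subgroup F₂hat)⁆, (⊤ : Subgroup F₂hat)⁆).topologicalClosure) :
    heisHom g = 1 := by
  refine Heis.eq_one_of_forall_map_eq_one _ fun M hM => ?_
  haveI : NeZero M := ⟨hM.ne'⟩
  letI : TopologicalSpace (Heis (ZMod M)) := ⊥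
  haveI : DiscreteTopology (Heis (ZMod M)) := ⟨rfl⟩
  obtain ⟨F, hF⟩ := exists_continuousMonoidHom_extend F₂ (Heis (ZMod M))
    ((Heis.map (Int.castRingHom (ZMod M))).comp heisHom)
  have hker : (⁅⁅(⊤ : Subgroup F₂hat), (⊤ : Subgroup F₂hat)⁆, (⊤ : Subgroup F₂hat)⁆).topologicalClosure
      ≤ F.toMonoidHom.ker := by
    refine Subgroup.topologicalClosure_minimal _ (Heis.commutator_commutator_le_ker F.toMonoidHom) ?_
    have : ((F.toMonoidHom.ker : Subgroup F₂hat) : Set F₂hat) = F ⁻¹' {1} := by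
      ext x; simp [MonoidHom.mem_ker]
    rw [this]
    exact (isClosed_discrete _).preimage F.continuous
  have h1 : F (eta g) = 1 := hker hg
  rw [eta_apply, hF] at h1
  exact h1

end Literature.AnabelianGeometry.EtaleTheta.SettingModel

end
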